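import Summits.Ventures.WeilGRH.UniformConductorFloorCellsBudget
import Summits.Ventures.WeilGRH.UniformConductorFloorCellsData
import Summits.Ventures.WeilGRH.UniformConductorFloorRungs
import Summits.Ventures.WeilGRH.RungLogBounds
import HarnessLib

/-!
# GRH arm (rh-explicit, venture WeilGRH): the cell certificate at `t = 1` — every character mod `q ≥ 256`

Cell `rh-explicit`, WEIL TRACK — GRH ARM (weil-grh-1).  Instance of `UniformFloor.weilPositivityOnChar_of_phi_budget`
(`UniformConductorFloorCellsBudget.lean`) at the window `t = 1`: `J = 40` cells (`δ = 1/20`), prime powers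
`n = 2, 3, 4, 5, 7` with shift indices `s_n = 13, 21, 27, 32, 38`, weights `w̄_n ≥ Λ(n)/√n`, and a positive vector `φ`
(found by the non-linear power iteration for the smeared translation pattern, rounded to 4 digits) with
`Σ_n w̄_n (A_{n,j} + B_{n,j}) ≤ ρ φ_j`, **`ρ = 2.1506`**, checked cell by cell by `norm_num` (the shift-by-shift
budget of `UniformConductorFloorRungs.lean` was `3.4164`).  Consequences:

* `weilPositivityOnChar_one_of_even_ge_256`, `…_odd_ge_80`, **`weilPositivityOnChar_one_of_ge_256`**:
  Weil positivity on `[-1, 1]` for EVERY Dirichlet character of EVERY modulus `q ≥ 256` (odd: `q ≥ 80`), uniformly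
  in the character's values, no `ζ` input, no kernel certificate (method floors `251` / `80`; landed crude floors `900` / `288`;
  sharp data floors `78` / `30`).

## References

* A. Weil (1952), (11) and the «lemme» p. 262 [Weil1952FormulesExplicites]; H. Yoshida (1992) §2, §6 [Yoshida1992].
-/

noncomputable section

open Complex Filter Set MeasureTheory
open scoped Real Topology ComplexConjugate ArithmeticFunction.vonMangoldt

namespace Summit.Ventures.WeilGRH

open Literature.NumberTheory.LFunctions

namespace UniformFloor

variable {q : ℕ}


/-! ## Shared numerics: `log 7` from below and the weights -/

/-- `log 7 ≥ 3 log 2 − 1/7 ≥ 1.9365843` (`log(7/8) ≥ 1 − 8/7`). [folklore] -/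
theorem log_seven_ge : (1.9365843 : ℝ) ≤ Real.log 7 := by
  have h2 := Real.log_two_gt_d9
  have h78 : 1 - (7 / 8 : ℝ)⁻¹ ≤ Real.log (7 / 8) := Real.one_sub_inv_le_log_of_pos (by norm_num)
  have e : Real.log (7 / 8 : ℝ) = Real.log 7 - 3 * Real.log 2 := by
    rw [Real.log_div (by norm_num) (by norm_num), show (8 : ℝ) = 2 ^ 3 by norm_num, Real.log_pow]
    push_cast; ring
  rw [e] at h78
  norm_num at h78
  linarith

/-- The weights dominate `Λ(n)/√n` for `n ≤ 7`. [folklore] -/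
theorem wbar7_ge (N : ℕ) (hN : N ≤ 7) : ∀ n ∈ Finset.range (N + 1), (Λ n : ℝ) / Real.sqrt n ≤ wbar7 n := by
  intro n hn
  have hn8 : n < 8 := by have := Finset.mem_range.1 hn; omega
  obtain ⟨h2, h3⟩ := vonMangoldt_two_three
  have hk2 := kprime_bounds.2
  have hk3 := kthree_le
  have hk5 := log_five_div_sqrt_five_le
  have hk7 := log_seven_div_sqrt_seven_le
  have hl2 := Real.log_two_lt_d9
  interval_cases n
  · simp [wbar7]
  · simp [wbar7]
  · rw [h2]; norm_num [wbar7]; exact hk2.trans (by norm_num)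
  · rw [h3]; norm_num [wbar7]; exact hk3.trans (by norm_num)
  · rw [vonMangoldt_four, sqrt_four_eq_two]; norm_num [wbar7]; linarith
  · rw [vonMangoldt_five]; norm_num [wbar7]; exact hk5.trans (by norm_num)
  · simp [vonMangoldt_six, wbar7]
  · rw [vonMangoldt_seven]; norm_num [wbar7]; exact hk7.trans (by norm_num)

/-! ## Shift brackets at `t = 1`, `J = 40` -/

/-- `s_n δ ≤ log n ≤ (s_n + 1)δ`, `δ = 1/20`, `s = 13, 21, 27, 32, 35, 38` at `n = 2, …, 7`. [folklore] -/
theorem one40_shifts : ∀ n ∈ Finset.range (7 + 1),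
    ((sOne40 n : ℤ) : ℝ) * (2 * 1 / ((40 : ℕ) : ℝ)) ≤ Real.log n ∧
      Real.log n ≤ (((sOne40 n : ℤ) : ℝ) + 1) * (2 * 1 / ((40 : ℕ) : ℝ)) := by
  intro n hn
  have hn8 : n < 8 := by have := Finset.mem_range.1 hn; omega
  have h2 := Real.log_two_gt_d9; have h2' := Real.log_two_lt_d9
  have h3 := Real.log_three_gt_d9; have h3' := Real.log_three_lt_d9
  have h5 := Real.log_five_gt_d9; have h5' := Real.log_five_lt_d9
  have h7 := log_seven_ge; have h7' := log_seven_le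
  have e4 : Real.log 4 = 2 * Real.log 2 := by
    rw [show (4 : ℝ) = 2 ^ 2 by norm_num, Real.log_pow]; push_cast; ring
  have e6 : Real.log 6 = Real.log 2 + Real.log 3 := by
    rw [show (6 : ℝ) = 2 * 3 by norm_num, Real.log_mul (by norm_num) (by norm_num)]
  interval_cases n
  · norm_num [sOne40]
  · norm_num [sOne40]
  · norm_num [sOne40]; constructor <;> linarith
  · norm_num [sOne40]; constructor <;> linarith
  · norm_num [sOne40, e4]; constructor <;> linarith
  · norm_num [sOne40]; constructor <;> linarith
  · norm_num [sOne40, e6]; constructor <;> linarith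
  · norm_num [sOne40]; constructor <;> linarith

/-! ## The certificate, cell by cell -/
/-- `3389/10000 ≤ φ_j` on `[0, 40)`. [folklore] -/
theorem one40_philo : ∀ i : ℤ, 0 ≤ i → i < ((40 : ℕ) : ℤ) → (3389 / 10000 : ℝ) ≤ phiOne40 i := by
  intro i h0 h1
  push_cast at h1
  interval_cases i <;> norm_num [phiOne40]

/-- `φ_j ≤ 1`. [folklore] -/
theorem one40_phihi : ∀ i : ℤ, phiOne40 i ≤ (1 : ℝ) := by
  intro i
  by_cases h : 0 ≤ i ∧ i < 40
  · obtain ⟨h0, h1⟩ := h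
    interval_cases i <;> norm_num [phiOne40]
  · simp only [phiOne40, if_neg h]
    norm_num

/-- `φ_j = 0` off `[0, 40)`. [folklore] -/
theorem one40_phiout : ∀ i : ℤ, i < 0 ∨ ((40 : ℕ) : ℤ) ≤ i → phiOne40 i = 0 := by
  intro i hi
  have h : ¬ (0 ≤ i ∧ i < 40) := by omega
  simp only [phiOne40, if_neg h]

/-- Cell `0` of the `one40` certificate (`ρ = 10753/5000`). [folklore] -/
theorem one40_cell_0 :
    ∑ n ∈ Finset.range (7 + 1), wbar7 n *
      (max (phiOne40 (((0 : ℕ) : ℤ) - sOne40 n - 1)) (phiOne40 (((0 : ℕ) : ℤ) - sOne40 n)) +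
        max (phiOne40 (((0 : ℕ) : ℤ) + sOne40 n)) (phiOne40 (((0 : ℕ) : ℤ) + sOne40 n + 1))) ≤
      (10753 / 5000 : ℝ) * phiOne40 ((0 : ℕ) : ℤ) := by
  simp only [Finset.sum_range_succ, Finset.sum_range_zero, wbar7, phiOne40, sOne40]
  norm_num

/-- Cell `1` of the `one40` certificate (`ρ = 10753/5000`). [folklore] -/
theorem one40_cell_1 :
    ∑ n ∈ Finset.range (7 + 1), wbar7 n *
      (max (phiOne40 (((1 : ℕ) : ℤ) - sOne40 n - 1)) (phiOne40 (((1 : ℕ) : ℤ) - sOne40 n)) +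
        max (phiOne40 (((1 : ℕ) : ℤ) + sOne40 n)) (phiOne40 (((1 : ℕ) : ℤ) + sOne40 n + 1))) ≤
      (10753 / 5000 : ℝ) * phiOne40 ((1 : ℕ) : ℤ) := by
  simp only [Finset.sum_range_succ, Finset.sum_range_zero, wbar7, phiOne40, sOne40]
  norm_num

/-- Cell `2` of the `one40` certificate (`ρ = 10753/5000`). [folklore] -/
theorem one40_cell_2 :
    ∑ n ∈ Finset.range (7 + 1), wbar7 n *
      (max (phiOne40 (((2 : ℕ) : ℤ) - sOne40 n - 1)) (phiOne40 (((2 : ℕ) : ℤ) - sOne40 n)) +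
        max (phiOne40 (((2 : ℕ) : ℤ) + sOne40 n)) (phiOne40 (((2 : ℕ) : ℤ) + sOne40 n + 1))) ≤
      (10753 / 5000 : ℝ) * phiOne40 ((2 : ℕ) : ℤ) := by
  simp only [Finset.sum_range_succ, Finset.sum_range_zero, wbar7, phiOne40, sOne40]
  norm_num

/-- Cell `3` of the `one40` certificate (`ρ = 10753/5000`). [folklore] -/
theorem one40_cell_3 :
    ∑ n ∈ Finset.range (7 + 1), wbar7 n *
      (max (phiOne40 (((3 : ℕ) : ℤ) - sOne40 n - 1)) (phiOne40 (((3 : ℕ) : ℤ) - sOne40 n)) +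
        max (phiOne40 (((3 : ℕ) : ℤ) + sOne40 n)) (phiOne40 (((3 : ℕ) : ℤ) + sOne40 n + 1))) ≤
      (10753 / 5000 : ℝ) * phiOne40 ((3 : ℕ) : ℤ) := by
  simp only [Finset.sum_range_succ, Finset.sum_range_zero, wbar7, phiOne40, sOne40]
  norm_num

/-- Cell `4` of the `one40` certificate (`ρ = 10753/5000`). [folklore] -/
theorem one40_cell_4 :
    ∑ n ∈ Finset.range (7 + 1), wbar7 n *
      (max (phiOne40 (((4 : ℕ) : ℤ) - sOne40 n - 1)) (phiOne40 (((4 : ℕ) : ℤ) - sOne40 n)) +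
        max (phiOne40 (((4 : ℕ) : ℤ) + sOne40 n)) (phiOne40 (((4 : ℕ) : ℤ) + sOne40 n + 1))) ≤
      (10753 / 5000 : ℝ) * phiOne40 ((4 : ℕ) : ℤ) := by
  simp only [Finset.sum_range_succ, Finset.sum_range_zero, wbar7, phiOne40, sOne40]
  norm_num

/-- Cell `5` of the `one40` certificate (`ρ = 10753/5000`). [folklore] -/
theorem one40_cell_5 :
    ∑ n ∈ Finset.range (7 + 1), wbar7 n *
      (max (phiOne40 (((5 : ℕ) : ℤ) - sOne40 n - 1)) (phiOne40 (((5 : ℕ) : ℤ) - sOne40 n)) +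
        max (phiOne40 (((5 : ℕ) : ℤ) + sOne40 n)) (phiOne40 (((5 : ℕ) : ℤ) + sOne40 n + 1))) ≤
      (10753 / 5000 : ℝ) * phiOne40 ((5 : ℕ) : ℤ) := by
  simp only [Finset.sum_range_succ, Finset.sum_range_zero, wbar7, phiOne40, sOne40]
  norm_num

/-- Cell `6` of the `one40` certificate (`ρ = 10753/5000`). [folklore] -/
theorem one40_cell_6 :
    ∑ n ∈ Finset.range (7 + 1), wbar7 n *
      (max (phiOne40 (((6 : ℕ) : ℤ) - sOne40 n - 1)) (phiOne40 (((6 : ℕ) : ℤ) - sOne40 n)) +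
        max (phiOne40 (((6 : ℕ) : ℤ) + sOne40 n)) (phiOne40 (((6 : ℕ) : ℤ) + sOne40 n + 1))) ≤
      (10753 / 5000 : ℝ) * phiOne40 ((6 : ℕ) : ℤ) := by
  simp only [Finset.sum_range_succ, Finset.sum_range_zero, wbar7, phiOne40, sOne40]
  norm_num

/-- Cell `7` of the `one40` certificate (`ρ = 10753/5000`). [folklore] -/
theorem one40_cell_7 :
    ∑ n ∈ Finset.range (7 + 1), wbar7 n *
      (max (phiOne40 (((7 : ℕ) : ℤ) - sOne40 n - 1)) (phiOne40 (((7 : ℕ) : ℤ) - sOne40 n)) +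
        max (phiOne40 (((7 : ℕ) : ℤ) + sOne40 n)) (phiOne40 (((7 : ℕ) : ℤ) + sOne40 n + 1))) ≤
      (10753 / 5000 : ℝ) * phiOne40 ((7 : ℕ) : ℤ) := by
  simp only [Finset.sum_range_succ, Finset.sum_range_zero, wbar7, phiOne40, sOne40]
  norm_num

/-- Cell `8` of the `one40` certificate (`ρ = 10753/5000`). [folklore] -/
theorem one40_cell_8 :
    ∑ n ∈ Finset.range (7 + 1), wbar7 n *
      (max (phiOne40 (((8 : ℕ) : ℤ) - sOne40 n - 1)) (phiOne40 (((8 : ℕ) : ℤ) - sOne40 n)) +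
        max (phiOne40 (((8 : ℕ) : ℤ) + sOne40 n)) (phiOne40 (((8 : ℕ) : ℤ) + sOne40 n + 1))) ≤
      (10753 / 5000 : ℝ) * phiOne40 ((8 : ℕ) : ℤ) := by
  simp only [Finset.sum_range_succ, Finset.sum_range_zero, wbar7, phiOne40, sOne40]
  norm_num

/-- Cell `9` of the `one40` certificate (`ρ = 10753/5000`). [folklore] -/
theorem one40_cell_9 :
    ∑ n ∈ Finset.range (7 + 1), wbar7 n *
      (max (phiOne40 (((9 : ℕ) : ℤ) - sOne40 n - 1)) (phiOne40 (((9 : ℕ) : ℤ) - sOne40 n)) +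
        max (phiOne40 (((9 : ℕ) : ℤ) + sOne40 n)) (phiOne40 (((9 : ℕ) : ℤ) + sOne40 n + 1))) ≤
      (10753 / 5000 : ℝ) * phiOne40 ((9 : ℕ) : ℤ) := by
  simp only [Finset.sum_range_succ, Finset.sum_range_zero, wbar7, phiOne40, sOne40]
  norm_num

/-- Cell `10` of the `one40` certificate (`ρ = 10753/5000`). [folklore] -/
theorem one40_cell_10 :
    ∑ n ∈ Finset.range (7 + 1), wbar7 n *
      (max (phiOne40 (((10 : ℕ) : ℤ) - sOne40 n - 1)) (phiOne40 (((10 : ℕ) : ℤ) - sOne40 n)) +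
        max (phiOne40 (((10 : ℕ) : ℤ) + sOne40 n)) (phiOne40 (((10 : ℕ) : ℤ) + sOne40 n + 1))) ≤
      (10753 / 5000 : ℝ) * phiOne40 ((10 : ℕ) : ℤ) := by
  simp only [Finset.sum_range_succ, Finset.sum_range_zero, wbar7, phiOne40, sOne40]
  norm_num

/-- Cell `11` of the `one40` certificate (`ρ = 10753/5000`). [folklore] -/
theorem one40_cell_11 :
    ∑ n ∈ Finset.range (7 + 1), wbar7 n *
      (max (phiOne40 (((11 : ℕ) : ℤ) - sOne40 n - 1)) (phiOne40 (((11 : ℕ) : ℤ) - sOne40 n)) +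
        max (phiOne40 (((11 : ℕ) : ℤ) + sOne40 n)) (phiOne40 (((11 : ℕ) : ℤ) + sOne40 n + 1))) ≤
      (10753 / 5000 : ℝ) * phiOne40 ((11 : ℕ) : ℤ) := by
  simp only [Finset.sum_range_succ, Finset.sum_range_zero, wbar7, phiOne40, sOne40]
  norm_num

/-- Cell `12` of the `one40` certificate (`ρ = 10753/5000`). [folklore] -/
theorem one40_cell_12 :
    ∑ n ∈ Finset.range (7 + 1), wbar7 n *
      (max (phiOne40 (((12 : ℕ) : ℤ) - sOne40 n - 1)) (phiOne40 (((12 : ℕ) : ℤ) - sOne40 n)) +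
        max (phiOne40 (((12 : ℕ) : ℤ) + sOne40 n)) (phiOne40 (((12 : ℕ) : ℤ) + sOne40 n + 1))) ≤
      (10753 / 5000 : ℝ) * phiOne40 ((12 : ℕ) : ℤ) := by
  simp only [Finset.sum_range_succ, Finset.sum_range_zero, wbar7, phiOne40, sOne40]
  norm_num

/-- Cell `13` of the `one40` certificate (`ρ = 10753/5000`). [folklore] -/
theorem one40_cell_13 :
    ∑ n ∈ Finset.range (7 + 1), wbar7 n *
      (max (phiOne40 (((13 : ℕ) : ℤ) - sOne40 n - 1)) (phiOne40 (((13 : ℕ) : ℤ) - sOne40 n)) +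
        max (phiOne40 (((13 : ℕ) : ℤ) + sOne40 n)) (phiOne40 (((13 : ℕ) : ℤ) + sOne40 n + 1))) ≤
      (10753 / 5000 : ℝ) * phiOne40 ((13 : ℕ) : ℤ) := by
  simp only [Finset.sum_range_succ, Finset.sum_range_zero, wbar7, phiOne40, sOne40]
  norm_num

/-- Cell `14` of the `one40` certificate (`ρ = 10753/5000`). [folklore] -/
theorem one40_cell_14 :
    ∑ n ∈ Finset.range (7 + 1), wbar7 n *
      (max (phiOne40 (((14 : ℕ) : ℤ) - sOne40 n - 1)) (phiOne40 (((14 : ℕ) : ℤ) - sOne40 n)) +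
        max (phiOne40 (((14 : ℕ) : ℤ) + sOne40 n)) (phiOne40 (((14 : ℕ) : ℤ) + sOne40 n + 1))) ≤
      (10753 / 5000 : ℝ) * phiOne40 ((14 : ℕ) : ℤ) := by
  simp only [Finset.sum_range_succ, Finset.sum_range_zero, wbar7, phiOne40, sOne40]
  norm_num

/-- Cell `15` of the `one40` certificate (`ρ = 10753/5000`). [folklore] -/
theorem one40_cell_15 :
    ∑ n ∈ Finset.range (7 + 1), wbar7 n *
      (max (phiOne40 (((15 : ℕ) : ℤ) - sOne40 n - 1)) (phiOne40 (((15 : ℕ) : ℤ) - sOne40 n)) +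
        max (phiOne40 (((15 : ℕ) : ℤ) + sOne40 n)) (phiOne40 (((15 : ℕ) : ℤ) + sOne40 n + 1))) ≤
      (10753 / 5000 : ℝ) * phiOne40 ((15 : ℕ) : ℤ) := by
  simp only [Finset.sum_range_succ, Finset.sum_range_zero, wbar7, phiOne40, sOne40]
  norm_num

/-- Cell `16` of the `one40` certificate (`ρ = 10753/5000`). [folklore] -/
theorem one40_cell_16 :
    ∑ n ∈ Finset.range (7 + 1), wbar7 n *
      (max (phiOne40 (((16 : ℕ) : ℤ) - sOne40 n - 1)) (phiOne40 (((16 : ℕ) : ℤ) - sOne40 n)) +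
        max (phiOne40 (((16 : ℕ) : ℤ) + sOne40 n)) (phiOne40 (((16 : ℕ) : ℤ) + sOne40 n + 1))) ≤
      (10753 / 5000 : ℝ) * phiOne40 ((16 : ℕ) : ℤ) := by
  simp only [Finset.sum_range_succ, Finset.sum_range_zero, wbar7, phiOne40, sOne40]
  norm_num

/-- Cell `17` of the `one40` certificate (`ρ = 10753/5000`). [folklore] -/
theorem one40_cell_17 :
    ∑ n ∈ Finset.range (7 + 1), wbar7 n *
      (max (phiOne40 (((17 : ℕ) : ℤ) - sOne40 n - 1)) (phiOne40 (((17 : ℕ) : ℤ) - sOne40 n)) +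
        max (phiOne40 (((17 : ℕ) : ℤ) + sOne40 n)) (phiOne40 (((17 : ℕ) : ℤ) + sOne40 n + 1))) ≤
      (10753 / 5000 : ℝ) * phiOne40 ((17 : ℕ) : ℤ) := by
  simp only [Finset.sum_range_succ, Finset.sum_range_zero, wbar7, phiOne40, sOne40]
  norm_num

/-- Cell `18` of the `one40` certificate (`ρ = 10753/5000`). [folklore] -/
theorem one40_cell_18 :
    ∑ n ∈ Finset.range (7 + 1), wbar7 n *
      (max (phiOne40 (((18 : ℕ) : ℤ) - sOne40 n - 1)) (phiOne40 (((18 : ℕ) : ℤ) - sOne40 n)) +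
        max (phiOne40 (((18 : ℕ) : ℤ) + sOne40 n)) (phiOne40 (((18 : ℕ) : ℤ) + sOne40 n + 1))) ≤
      (10753 / 5000 : ℝ) * phiOne40 ((18 : ℕ) : ℤ) := by
  simp only [Finset.sum_range_succ, Finset.sum_range_zero, wbar7, phiOne40, sOne40]
  norm_num

/-- Cell `19` of the `one40` certificate (`ρ = 10753/5000`). [folklore] -/
theorem one40_cell_19 :
    ∑ n ∈ Finset.range (7 + 1), wbar7 n *
      (max (phiOne40 (((19 : ℕ) : ℤ) - sOne40 n - 1)) (phiOne40 (((19 : ℕ) : ℤ) - sOne40 n)) +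
        max (phiOne40 (((19 : ℕ) : ℤ) + sOne40 n)) (phiOne40 (((19 : ℕ) : ℤ) + sOne40 n + 1))) ≤
      (10753 / 5000 : ℝ) * phiOne40 ((19 : ℕ) : ℤ) := by
  simp only [Finset.sum_range_succ, Finset.sum_range_zero, wbar7, phiOne40, sOne40]
  norm_num
end UniformFloor

end Summit.Ventures.WeilGRH

end
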